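import Summits.Ventures.QEC.Census.BB.A1s_n192_k4_0fa3ae82.Wit
import Summits.Ventures.QEC.Census.BB.A1s_n180_k4_0383c42c.WitA
import Summits.Ventures.QEC.Census.BB.A1s_n180_k4_0383c42c.WitB
import Summits.Ventures.QEC.Census.BB.A1s_n180_k4_0383c42c.WitC
import Summits.Ventures.QEC.Census.BB.A1s_n180_k4_0383c42c.WitD
import HarnessLib

set_option Elab.async false
set_option maxRecDepth 200000

/-!
# `[[180,4,18]]` one-level cover certificate — WITNESS TABLE of the level-1 list: the kernel-generated orbit table `orbTab eTr eInv 45 eReps`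
# is a valid witness table (`witnessOK`) — qec-type-10's round-trip check `orbCheck` assembled from the 11 chunk verdicts of `WitA/WitB/WitC/WitD`
(search-9 g5's `A1s_n192_k4_0fa3ae82.orbCheckAux_append`, imported from the `[[192,4,18]]` chain's `Wit`) and `CertCoverBatch.witnessOK_of_orbCheck`; the 45 downstairs tables `ePermqs` are permutation tables
(`permListOK`). qec-search-9 g6 (pattern of search-9 g5 `Wit` p545098). Theorems only; KERNEL.
-/

namespace Summit.Ventures.QEC.Census.A1s_n180_k4_0383c42c

open Matrix Summit.Ventures.QEC.Census Literature.InformationTheory.QuantumCodes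

set_option maxHeartbeats 400000000 in
/-- The chunks are `eReps`. -/
theorem repsC_eq : A1s_n180_k4_0383c42c.repsC0 ++ A1s_n180_k4_0383c42c.repsC1 ++ A1s_n180_k4_0383c42c.repsC2 ++ A1s_n180_k4_0383c42c.repsC3 ++ A1s_n180_k4_0383c42c.repsC4 ++ A1s_n180_k4_0383c42c.repsC5 ++ A1s_n180_k4_0383c42c.repsC6 ++ A1s_n180_k4_0383c42c.repsC7 ++ A1s_n180_k4_0383c42c.repsC8 ++ A1s_n180_k4_0383c42c.repsC9 ++ A1s_n180_k4_0383c42c.repsC10 = A1s_n180_k4_0383c42c.eReps := by decide +kernel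

/-- **The round trip of the whole orbit table.** -/
theorem eOrb_check : orbCheck A1s_n180_k4_0383c42c.ePermqs A1s_n180_k4_0383c42c.eTr A1s_n180_k4_0383c42c.eInv 45 A1s_n180_k4_0383c42c.eReps = true := by
  rw [← repsC_eq]
  simp only [orbCheck, A1s_n192_k4_0fa3ae82.orbCheckAux_append, Bool.and_eq_true]
  exact ⟨⟨⟨⟨⟨⟨⟨⟨⟨⟨orbChk0, orbChk1⟩, orbChk2⟩, orbChk3⟩, orbChk4⟩, orbChk5⟩, orbChk6⟩, orbChk7⟩, orbChk8⟩, orbChk9⟩, orbChk10⟩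

set_option maxHeartbeats 400000000 in
/-- The 45 downstairs tables are permutation tables of the 90 qubits. -/
theorem ePermqs_ok : ∀ i : ℕ, i < A1s_n180_k4_0383c42c.ePermqs.length → permListOK 90 (A1s_n180_k4_0383c42c.ePermqs.getD i []) = true := by
  have h : ((List.range 45).all fun i => permListOK 90 (ePermqs.getD i [])) = true := by decide +kernel
  have hl : ePermqs.length = 45 := by decide
  intro i hi
  rw [hl] at hi
  simp only [List.all_eq_true, List.mem_range] at h
  exact h i hi

/-- ★ **`wit_ok`**: the generated orbit table is a valid witness table for `eReps` over `ePermqs`. -/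
theorem wit_ok : witnessOK 90 A1s_n180_k4_0383c42c.ePermqs A1s_n180_k4_0383c42c.eReps (orbTab A1s_n180_k4_0383c42c.eTr A1s_n180_k4_0383c42c.eInv 45 A1s_n180_k4_0383c42c.eReps) = true := witnessOK_of_orbCheck ePermqs_ok eOrb_check

/-- `hcw`: the orbit word list is covered by its own table. -/
theorem hcw : coveredOK A1s_n180_k4_0383c42c.eOrb (orbTab A1s_n180_k4_0383c42c.eTr A1s_n180_k4_0383c42c.eInv 45 A1s_n180_k4_0383c42c.eReps) = true := coveredOK_orbWords eReps

end Summit.Ventures.QEC.Census.A1s_n180_k4_0383c42c
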